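import Summits.Ventures.CertifiedArithmetic.LowPrec.DoubleRoundingFMAWide
import Summits.Ventures.CertifiedArithmetic.LowPrec.DoubleRoundingGmidTieBelow
import Summits.Ventures.CertifiedArithmetic.LowPrec.DoubleRoundingStripLaws

/-!
# THEOREM D-fma-W as a criterion: the witnesses, the `iff`, the prime reading, the named cells

HONEST FRAMING: certified error envelopes and provably optimal rounding/accumulation schemes for
low-precision formats under stated cost models; every table by two implementations; no hardware
or vendor claims.

`DoubleRoundingFMAWide.lean` proves `fmaWideTest φ ψ → DFma φ ψ` for registers with
`P_ψ ≥ 3 P_φ` (side conditions of clause F).  Here: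

* §1–2 THE CONVERSE, for every pair of records with `m_φ + 2 ≤ m_ψ` (no `3 P_φ` needed):
  a midpoint of `φ` available in the binade `2^P_ψ` quanta whose significand
  `2^P_φ + 2j + 1 = a₁·b₁` factors through `sigPairTest` is HIT by the data `a = a₁·2^(m_ψ-m_φ)`
  quanta, `b = b₁` (the integer), `c = ±quantum φ` (`not_dFma_of_sigPairTest`): `a·b` is the
  midpoint exactly and `c` is half the spacing of `ψ` there, so `fl_ψ` returns the midpoint (an
  even datum of `ψ`, `DoubleRoundingGmidBelow.lean` §2 for `+`, `DoubleRoundingGmidTieBelow.lean`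
  for `-`; the sign is chosen by the parity of `2^m_φ + j` so that the tie of `φ` then goes the
  wrong way).  Realizability of `b₁` as a datum is the range hypothesis `hR`
  (`bias + 2m ≤ P_ψ` or `2^(bias+2m) ≤ maxScaled`); THEOREM N-fma-A is the instance
  `a₁ = 3`, `b₁ = 2^m_φ - 1`.
* §3 THE CRITERION `dFma_wide_iff`: under clause F's side conditions, `P_ψ ≥ 3 P_φ`, `m_φ ≥ 1`,
  `bias φ ≥ 1` and `hR`, `DFma φ ψ ↔ fmaWideTest φ ψ`.
* §4 THE PRIME READING.  `sigPairTest P (2^P + 2j + 1)` says the odd number is composite; among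
  three consecutive odd numbers one is a multiple of `3`, so at most the first TWO midpoints of
  the binade can be harmless (`exists_sigPairTest_lt_three`): with `P_φ ≥ 3`, `DFma` FAILS as soon
  as three midpoints of the binade `2^P_ψ` are finite in `φ` (`not_dFma_wide_of_three_le`) — in
  particular whenever that binade is full —, and in the boundary case (top binade of `φ` = binade
  `2^P_ψ`) `DFma` holds iff `topMan φ ≤ w*(P_φ)` where `w*(P) ∈ {0, 1, 2}` counts the leading
  primes among `2^P + 1, 2^P + 3`: `w*(P) ≥ 1` iff `2^P + 1` is a FERMAT PRIME
  (the known ones: `P ∈ {1, 2, 4, 8, 16}`), table `fmaWide_wstar` for `P ≤ 16` (`w*(4) = 2`: `17, 19`;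
  `w*(8) = 1`: `257`, `259 = 7·37`; `w*(16) = 2`: `65537, 65539`).  For `P_φ = 2` both
  significands `5, 7` are prime: EVERY FP4-like source passes, whatever its exponent range
  (`fmaWideTest_of_manBits_eq_one`).
* §5 THE NAMED CELLS: the hypotheses of the criterion hold on `13` cells of the `13 × 13` matrix
  (targets binary16 / bfloat16 / binary32) and on the `12` sources other than binary32 of the
  binary64 column; the test agrees with the matrix of `DoubleRoundingFMAMatrix.lean` on all of
  them (`10` hold, e5m2 / binary8p3 / binary8p3f → binary32 fail at `9 = 3·3`; binary64: all but
  bfloat16, which fails at `259 = 7·37`).  Implementation A = `code/enum/fma_wide_law.py`,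
  certificate `certs/enum/DOUBLE-ROUNDING-FMA-WIDE.json`.

References: [BoldoMelquiond2008] Thm 3; [MartinDorelMelquiondMuller2013] Property 2.1;
[Roux2014] §2; [HighamPranesh2019] p. C589. No hardware or vendor claims.
-/

namespace Summit.Ventures.CertifiedArithmetic

open Literature.ComputerArithmetic.FloatingPoint
open Literature.ComputerArithmetic.FloatingPoint.Format
open Literature.ComputerArithmetic.FloatingPoint.MiniFloat

/-! ## §1 The witness data -/

/-- THE WIDE DATA of a record `φ` with `bias ≥ 1`: `a = a₁·2^k` quanta, `b = b₁` (the integer: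
`b₁·2^(m+bias-1)` quanta) and `c = 1` quantum, for significands `1 ≤ a₁`, `b₁ < 2^P` in range,
have `a·b = a₁·b₁·2^k` quanta exactly. [this packet] -/
theorem exists_fmaWide_data {φ : Format} (hb : 1 ≤ φ.bias) {a₁ b₁ k : ℕ} (h1a : 1 ≤ a₁)
    (ha : a₁ < 2 ^ (φ.manBits + 1)) (hb₁ : b₁ < 2 ^ (φ.manBits + 1))
    (hak : a₁ * 2 ^ k ≤ φ.maxScaled) (hbk : b₁ * 2 ^ (φ.manBits + (φ.bias - 1)) ≤ φ.maxScaled) :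
    ∃ a b c : MiniFloat φ, a.toRat * b.toRat = ((a₁ * b₁ * 2 ^ k : ℕ) : ℚ) * φ.quantum ∧
      c.toRat = φ.quantum := by
  have hunit := two_pow_mul_quantum_eq_one hb
  obtain ⟨a, ha'⟩ := exists_toRat_eq_natMul (representable_mul_pow ha hak)
  obtain ⟨b, hb'⟩ := exists_toRat_eq_natMul (representable_mul_pow hb₁ hbk)
  have h1le : 1 ≤ φ.maxScaled :=
    le_trans (le_trans h1a (Nat.le_mul_of_pos_right _ (Nat.two_pow_pos k))) hak
  have h1lt : 1 < 2 ^ (φ.manBits + 1) := by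
    have := Nat.one_le_two_pow (n := φ.manBits); rw [pow_succ]; omega
  obtain ⟨c, hc⟩ := exists_toRat_eq_natMul (representable_of_lt_pow (φ := φ) (n := 1) h1lt h1le)
  refine ⟨a, b, c, ?_, by rw [hc]; push_cast; ring⟩
  rw [ha', hb']
  push_cast
  linear_combination ((a₁ : ℚ) * b₁ * 2 ^ k * φ.quantum) * hunit

/-! ## §2 A factorable available midpoint refutes `DFma` -/

/-- THE CONVERSE OF THEOREM D-fma-W, pointwise: for records `φ ⊆ ψ` (`hq`, `hM`) with
`m_ψ = m_φ + k`, `k ≥ 2`, `m_φ ≥ 1`, `bias φ ≥ 1` and the range hypothesis `hR`, a midpoint of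
`φ` of the binade `2^(m_ψ+1)` quanta that is finite in `φ` (`hu`) and whose significand
`2^P_φ + 2j + 1` passes `sigPairTest` refutes `DFma φ ψ`: `a = a₁·2^k`, `b = b₁`,
`c = ±quantum φ` slip. [this packet] -/
theorem not_dFma_of_sigPairTest {φ ψ : Format} (hq : ψ.qexp ≤ φ.qexp)
    (hM : φ.maxScaled * 2 ^ (φ.qexp - ψ.qexp).toNat ≤ ψ.maxScaled) (h1 : 1 ≤ φ.manBits)
    (hb : 1 ≤ φ.bias) {k : ℕ} (hk : ψ.manBits = φ.manBits + k) (hk2 : 2 ≤ k)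
    (hR : φ.bias + 2 * φ.manBits ≤ ψ.manBits + 1 ∨ 2 ^ (φ.bias + 2 * φ.manBits) ≤ φ.maxScaled)
    {j : ℕ} (hj : j < 2 ^ φ.manBits) (hu : (2 ^ φ.manBits + j + 1) * 2 ^ (k + 1) ≤ φ.maxScaled)
    (hs : sigPairTest (φ.manBits + 1) (2 ^ (φ.manBits + 1) + 2 * j + 1) = true) :
    ¬ DFma φ ψ := by
  -- the factorization `2^P + 2j + 1 = a₁ b₁`
  unfold sigPairTest at hs
  obtain ⟨a₁, ha₁m, ha₁⟩ := List.any_eq_true.mp hs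
  rw [List.mem_range] at ha₁m
  simp only [Bool.and_eq_true, decide_eq_true_eq] at ha₁
  obtain ⟨ha1, hmod⟩ := ha₁
  obtain ⟨b₁, hab⟩ : a₁ ∣ 2 ^ (φ.manBits + 1) + 2 * j + 1 := Nat.dvd_of_mod_eq_zero hmod
  set t := 2 ^ φ.manBits + j with htdef
  have hOt : 2 ^ (φ.manBits + 1) + 2 * j + 1 = 2 * t + 1 := by rw [htdef, pow_succ]; ring
  have hPle : (φ.manBits + 1) / 2 + 1 ≤ φ.manBits + 1 := by omega
  have ha₁lt : a₁ < 2 ^ (φ.manBits + 1) :=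
    lt_of_lt_of_le ha₁m (Nat.pow_le_pow_right (by norm_num) hPle)
  have hb₁lt : b₁ < 2 ^ (φ.manBits + 1) := by
    have h2 : 2 * b₁ ≤ a₁ * b₁ := Nat.mul_le_mul_right _ ha1
    have h3 : 2 ^ (φ.manBits + 1) = 2 * 2 ^ φ.manBits := by rw [pow_succ]; ring
    omega
  -- range bookkeeping
  have htlo : 2 ^ φ.manBits ≤ t := by omega
  have hthi : t < 2 ^ (φ.manBits + 1) := by rw [pow_succ]; omega
  have hak : a₁ * 2 ^ k ≤ φ.maxScaled := by
    refine le_trans ?_ hu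
    calc a₁ * 2 ^ k ≤ 2 ^ (φ.manBits + 1) * 2 ^ k := Nat.mul_le_mul_right _ ha₁lt.le
      _ = 2 ^ φ.manBits * 2 ^ (k + 1) := by rw [pow_succ, pow_succ]; ring
      _ ≤ (t + 1) * 2 ^ (k + 1) := Nat.mul_le_mul_right _ (by omega)
  have hbk : b₁ * 2 ^ (φ.manBits + (φ.bias - 1)) ≤ φ.maxScaled := by
    have h2 : b₁ * 2 ^ (φ.manBits + (φ.bias - 1)) ≤ 2 ^ (φ.bias + 2 * φ.manBits) := by
      calc b₁ * 2 ^ (φ.manBits + (φ.bias - 1))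
          ≤ 2 ^ (φ.manBits + 1) * 2 ^ (φ.manBits + (φ.bias - 1)) :=
            Nat.mul_le_mul_right _ hb₁lt.le
        _ = 2 ^ (φ.bias + 2 * φ.manBits) := by rw [← pow_add]; congr 1; omega
    rcases hR with hR | hR
    · refine le_trans h2 (le_trans ?_ hu)
      calc 2 ^ (φ.bias + 2 * φ.manBits) ≤ 2 ^ (φ.manBits + (k + 1)) :=
            Nat.pow_le_pow_right (by norm_num) (by omega)
        _ = 2 ^ φ.manBits * 2 ^ (k + 1) := pow_add _ _ _
        _ ≤ (t + 1) * 2 ^ (k + 1) := Nat.mul_le_mul_right _ (by omega)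
    · exact le_trans h2 hR
  obtain ⟨a, b, c, habq, hcq⟩ := exists_fmaWide_data hb (by omega) ha₁lt hb₁lt hak hbk
  rw [← hab, hOt] at habq
  -- the slip: `c = +quantum` for `t` even, `-quantum` for `t` odd
  set d := (φ.qexp - ψ.qexp).toNat with hd
  have hk' : ψ.manBits ≤ φ.manBits + k + d := by omega
  have hP2 : φ.manBits + 2 ≤ ψ.manBits := by omega
  have hδψ : 2 * φ.quantum = 2 ^ (φ.manBits + k + d + 1 - ψ.manBits) * ψ.quantum := by
    rw [show φ.manBits + k + d + 1 - ψ.manBits = d + 1 by omega, pow_succ,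
      quantum_eq_two_pow_mul hq]
    ring
  intro hD
  rcases Nat.even_or_odd t with ht | ht
  · have h' := hD a b c
    rw [habq, hcq] at h'
    exact roundNE_roundNE_ne_gmid_tie hq hM h1 hP2 ht htlo hthi hu hk' hδψ h'
  · have h' := hD a b c.flipSign
    rw [toRat_flipSign, habq, hcq, ← sub_eq_add_neg] at h'
    exact roundNE_roundNE_ne_gmid_tie_below hq hM h1 hP2 ht htlo hthi hu hk' hδψ h'

/-- THE CONVERSE OF THEOREM D-fma-W: for records `φ ⊆ ψ` (`embedsTest`) with `m_φ + 2 ≤ m_ψ`,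
`m_φ ≥ 1`, `bias φ ≥ 1` and the range hypothesis `hR`, a failing `fmaWideTest` refutes
`DFma φ ψ`. [this packet] -/
theorem not_dFma_of_fmaWideTest_eq_false {φ ψ : Format} (hE : embedsTest φ ψ = true)
    (h1 : 1 ≤ φ.manBits) (hP2 : φ.manBits + 2 ≤ ψ.manBits) (hb : 1 ≤ φ.bias)
    (hR : φ.bias + 2 * φ.manBits ≤ ψ.manBits + 1 ∨ 2 ^ (φ.bias + 2 * φ.manBits) ≤ φ.maxScaled)
    (hW : fmaWideTest φ ψ = false) : ¬ DFma φ ψ := by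
  have hE' := hE
  simp only [embedsTest, Bool.and_eq_true, decide_eq_true_eq] at hE'
  obtain ⟨⟨-, hq⟩, hM⟩ := hE'
  obtain ⟨k, hk⟩ : ∃ k, ψ.manBits = φ.manBits + k := ⟨ψ.manBits - φ.manBits, by omega⟩
  -- a failing index `j < fmaWideCount`
  have hne : ¬ fmaWideTest φ ψ = true := by rw [hW]; exact Bool.false_ne_true
  unfold fmaWideTest at hne
  rw [List.all_eq_true] at hne
  push Not at hne
  obtain ⟨j, hjm, hj⟩ := hne
  rw [List.mem_range] at hjm
  have hs : sigPairTest (φ.manBits + 1) (2 ^ (φ.manBits + 1) + 2 * j + 1) = true := by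
    simpa using hj
  -- availability: `j < 2^m` and `(2^m + j + 1)·2^(k+1) ≤ maxScaled`
  have htop := φ.topMan_lt
  unfold fmaWideCount at hjm
  by_cases hc1 : φ.manBits + φ.emaxCode ≤ ψ.manBits + 1
  · rw [if_pos hc1] at hjm; exact absurd hjm (Nat.not_lt_zero _)
  rw [if_neg hc1] at hjm
  have hmax : φ.maxScaled = (2 ^ φ.manBits + φ.topMan) * 2 ^ (φ.emaxCode - 1) := by
    unfold Format.maxScaled Format.scaled; rw [if_neg (by omega)]
  have hj2 : j < 2 ^ φ.manBits := by
    by_cases hc2 : φ.manBits + φ.emaxCode = ψ.manBits + 2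
    · rw [if_pos hc2] at hjm; omega
    · rw [if_neg hc2] at hjm; exact hjm
  have hu : (2 ^ φ.manBits + j + 1) * 2 ^ (k + 1) ≤ φ.maxScaled := by
    rw [hmax]
    by_cases hc2 : φ.manBits + φ.emaxCode = ψ.manBits + 2
    · rw [if_pos hc2] at hjm
      rw [show φ.emaxCode - 1 = k + 1 by omega]
      exact Nat.mul_le_mul_right _ (by omega)
    · rw [if_neg hc2] at hjm
      calc (2 ^ φ.manBits + j + 1) * 2 ^ (k + 1)
          ≤ (2 * 2 ^ φ.manBits) * 2 ^ (k + 1) := Nat.mul_le_mul_right _ (by omega)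
        _ = 2 ^ φ.manBits * 2 ^ (k + 2) := by rw [pow_succ 2 (k + 1)]; ring
        _ ≤ 2 ^ φ.manBits * 2 ^ (φ.emaxCode - 1) :=
            Nat.mul_le_mul_left _ (Nat.pow_le_pow_right (by norm_num) (by omega))
        _ ≤ (2 ^ φ.manBits + φ.topMan) * 2 ^ (φ.emaxCode - 1) :=
            Nat.mul_le_mul_right _ (Nat.le_add_right _ _)
  exact not_dFma_of_sigPairTest hq hM h1 hb hk (by omega) hR hj2 hu hs

/-! ## §3 The criterion -/

/-- THEOREM D-fma-W (every pair of format records): `F_φ ⊆ F_ψ`, `P_ψ ≥ 3 P_φ`,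
`bias_φ ≤ bias_ψ`, `L_ψ ≤ 2 L_φ`, `L_ψ + P_ψ ≤ L_φ`, `m_φ ≥ 1`, `bias φ ≥ 1` and the range
hypothesis `hR` (the integer `2^(P_φ+m_φ)` is at most `2^P_ψ` or a value of `φ`) decide the
double rounding of the FMA by the record alone: `DFma φ ψ ↔ fmaWideTest φ ψ` — one FMA of
`φ`-data in `ψ` converted to `φ` is correctly rounded for ALL data iff no midpoint of `φ` finite
in the binade `2^P_ψ` quanta has a significand `2^P_φ + 2j + 1` that is a product of two
`P_φ`-digit odd numbers.  Implementation A = `code/enum/fma_wide_law.py`. [this packet] -/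
theorem dFma_wide_iff {φ ψ : Format} (hE : embedsTest φ ψ = true)
    (hm3 : 3 * (φ.manBits + 1) ≤ ψ.manBits + 1) (hbias : φ.bias ≤ ψ.bias)
    (hq2 : ψ.qexp ≤ 2 * φ.qexp) (hnorm : ψ.qexp + ψ.manBits + 1 ≤ φ.qexp) (h1 : 1 ≤ φ.manBits)
    (hb : 1 ≤ φ.bias)
    (hR : φ.bias + 2 * φ.manBits ≤ ψ.manBits + 1 ∨ 2 ^ (φ.bias + 2 * φ.manBits) ≤ φ.maxScaled) :
    DFma φ ψ ↔ fmaWideTest φ ψ = true := by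
  refine ⟨fun hD => ?_, dFma_of_fmaWideTest hE hm3 hbias hq2 hnorm⟩
  by_contra hW
  exact not_dFma_of_fmaWideTest_eq_false hE h1 (by omega) hb hR (eq_false_of_ne_true hW) hD

/-! ## §4 The prime reading -/

/-- AMONG THREE CONSECUTIVE MIDPOINTS ONE IS FACTORABLE (`P ≥ 2`): one of `2^P + 1`, `2^P + 3`,
`2^P + 5` is a multiple of `3` (and `3 < 2^(⌊P/2⌋+1)`).  Hence at most the first two midpoints
of the binade `2^P_ψ` can be harmless. [folklore] -/
theorem exists_sigPairTest_lt_three {P : ℕ} (hP : 2 ≤ P) :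
    ∃ j < 3, sigPairTest P (2 ^ P + 2 * j + 1) = true := by
  have h3 : ¬ 3 ∣ 2 ^ P := fun h =>
    absurd (Nat.Prime.dvd_of_dvd_pow Nat.prime_three h) (by norm_num)
  have h4 : 3 < 2 ^ (P / 2 + 1) := by
    have : 2 ^ 2 ≤ 2 ^ (P / 2 + 1) := Nat.pow_le_pow_right (by norm_num) (by omega)
    omega
  have key : ∀ j, 3 ∣ 2 ^ P + 2 * j + 1 → sigPairTest P (2 ^ P + 2 * j + 1) = true := by
    intro j hj
    unfold sigPairTest
    rw [List.any_eq_true]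
    exact ⟨3, List.mem_range.mpr h4, by simp [Nat.mod_eq_zero_of_dvd hj]⟩
  have hmod : 2 ^ P % 3 ≠ 0 := fun h => h3 (Nat.dvd_of_mod_eq_zero h)
  by_cases h1 : (2 ^ P + 1) % 3 = 0
  · exact ⟨0, by norm_num, key 0 (Nat.dvd_of_mod_eq_zero (by simpa using h1))⟩
  · refine ⟨2, by norm_num, key 2 (Nat.dvd_of_mod_eq_zero ?_)⟩
    omega

/-- THREE FINITE MIDPOINTS OF THE BINADE `2^P_ψ` REFUTE `DFma` (`P_φ ≥ 3`): for records
`φ ⊆ ψ` with `m_φ ≥ 2`, `m_φ + 2 ≤ m_ψ`, `bias φ ≥ 1`, `hR` and `(2^m_φ + 3)·2^(m_ψ+1-m_φ)` quanta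
finite in `φ` — in particular whenever the binade `2^P_ψ` quanta is full —, `¬ DFma φ ψ`.
(THEOREM N-fma-A needed the significand `3·(2^P_φ - 1)`, i.e. half the binade.) [this packet] -/
theorem not_dFma_wide_of_three_le {φ ψ : Format} (hE : embedsTest φ ψ = true)
    (h2 : 2 ≤ φ.manBits) {k : ℕ} (hk : ψ.manBits = φ.manBits + k) (hk2 : 2 ≤ k)
    (hb : 1 ≤ φ.bias)
    (hR : φ.bias + 2 * φ.manBits ≤ ψ.manBits + 1 ∨ 2 ^ (φ.bias + 2 * φ.manBits) ≤ φ.maxScaled)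
    (hu : (2 ^ φ.manBits + 3) * 2 ^ (k + 1) ≤ φ.maxScaled) : ¬ DFma φ ψ := by
  have hE' := hE
  simp only [embedsTest, Bool.and_eq_true, decide_eq_true_eq] at hE'
  obtain ⟨⟨-, hq⟩, hM⟩ := hE'
  obtain ⟨j, hj3, hs⟩ := exists_sigPairTest_lt_three (P := φ.manBits + 1) (by omega)
  have h4 : 4 ≤ 2 ^ φ.manBits := by
    have : 2 ^ 2 ≤ 2 ^ φ.manBits := Nat.pow_le_pow_right (by norm_num) h2
    simpa using this
  exact not_dFma_of_sigPairTest hq hM (by omega) hb hk hk2 hR (by omega)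
    (le_trans (Nat.mul_le_mul_right _ (by omega)) hu) hs

/-- THE FP4 ROW IS ALWAYS SAFE: for `P_φ = 2` the only significands of midpoints are `5` and `7`,
both prime, so `fmaWideTest φ ψ` holds for EVERY register `ψ` — an e2m1-like source with any
exponent range is correctly FMA-rounded through any `ψ` with `P_ψ ≥ 6` and the side conditions
of clause F (`dFma_of_fmaWideTest`). [this packet] -/
theorem fmaWideTest_of_manBits_eq_one {φ ψ : Format} (h : φ.manBits = 1) :
    fmaWideTest φ ψ = true := by
  unfold fmaWideTest
  rw [List.all_eq_true]
  intro j hj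
  rw [List.mem_range] at hj
  have htop := φ.topMan_lt
  have h2 : 2 ^ φ.manBits = 2 := by rw [h, pow_one]
  have hj2 : j < 2 := by
    unfold fmaWideCount at hj; split_ifs at hj <;> omega
  rw [h]
  interval_cases j <;> decide

/-- THE TABLE `w*(P)`, `P = 2, …, 16`: the number of leading primes among the odd numbers
`2^P + 1, 2^P + 3, 2^P + 5, 2^P + 7` (at most `2` by `exists_sigPairTest_lt_three`; `≥ 1` iff
`2^P + 1` is a Fermat prime).  In the boundary case "top binade of `φ` = binade `2^P_ψ` quanta"
`fmaWideTest` holds iff `topMan φ ≤ w*(P_φ)`. [this packet] -/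
theorem fmaWide_wstar :
    (List.range 15).map (fun i => ((List.range 4).takeWhile
        fun j => ! sigPairTest (i + 2) (2 ^ (i + 2) + 2 * j + 1)).length)
      = [2, 0, 2, 0, 0, 0, 1, 0, 0, 0, 0, 0, 0, 0, 2] := by
  decide +kernel

/-! ## §5 The named records -/

/-- ON THE NAMED `13 × 13` MATRIX the hypotheses of `dFma_wide_iff` hold on exactly these `13`
cells (the `4` other cells with `P_Y ≥ 3 P_X` — e5m2 / binary8p3 / binary8p3f → binary16 and
bfloat16 → binary32 — violate `L_Y ≤ 2 L_X` or `L_Y + P_Y ≤ L_X`; they fail by THEOREM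
N-fma-A), and there the test agrees with the matrix `dFmaPairs` (`10` hold; e5m2, binary8p3,
binary8p3f → binary32 fail: the binade `2^24` quanta is full and `9 = 3·3`).
Implementation A tabulates the same cells. [this packet] -/
theorem dFmaWide_named : ∀ X ∈ namedFormats, ∀ Y ∈ namedFormats,
    ((embedsTest X Y && decide (3 * (X.manBits + 1) ≤ Y.manBits + 1) && decide (X.bias ≤ Y.bias)
      && decide (Y.qexp ≤ 2 * X.qexp) && decide (Y.qexp + Y.manBits + 1 ≤ X.qexp)
      && decide (1 ≤ X.manBits) && decide (1 ≤ X.bias)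
      && (decide (X.bias + 2 * X.manBits ≤ Y.manBits + 1)
        || decide (2 ^ (X.bias + 2 * X.manBits) ≤ X.maxScaled))) = true ↔
    (X, Y) ∈ [(E2M1, Binary16), (E2M1, BFloat16), (E2M1, Binary32), (E3M2, Binary16),
      (E3M2, Binary32), (E2M3, Binary32), (E4M3, Binary32), (E5M2, Binary32),
      (Binary8p3, Binary32), (Binary8p4, Binary32), (Binary8p5, Binary32),
      (Binary8p3F, Binary32), (Binary8p4F, Binary32)]) ∧
    ((X, Y) ∈ [(E2M1, Binary16), (E2M1, BFloat16), (E2M1, Binary32), (E3M2, Binary16),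
      (E3M2, Binary32), (E2M3, Binary32), (E4M3, Binary32), (E5M2, Binary32),
      (Binary8p3, Binary32), (Binary8p4, Binary32), (Binary8p5, Binary32),
      (Binary8p3F, Binary32), (Binary8p4F, Binary32)] →
      (fmaWideTest X Y = true ↔ (X, Y) ∈ dFmaPairs)) := by
  decide +kernel

/-- THE `13` NAMED WIDE CELLS DECIDED BY THE CRITERION ALONE (no witness search, no window):
`DFma X Y ↔ fmaWideTest X Y`, and the test's verdicts. [this packet] -/
theorem dFmaWide_cells : ∀ p ∈ [(E2M1, Binary16), (E2M1, BFloat16), (E2M1, Binary32),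
      (E3M2, Binary16), (E3M2, Binary32), (E2M3, Binary32), (E4M3, Binary32), (E5M2, Binary32),
      (Binary8p3, Binary32), (Binary8p4, Binary32), (Binary8p5, Binary32),
      (Binary8p3F, Binary32), (Binary8p4F, Binary32)],
    (DFma p.1 p.2 ↔ fmaWideTest p.1 p.2 = true) ∧
      (fmaWideTest p.1 p.2 = true ↔
        p ∉ [(E5M2, Binary32), (Binary8p3, Binary32), (Binary8p3F, Binary32)]) := by
  have H : ∀ p ∈ [(E2M1, Binary16), (E2M1, BFloat16), (E2M1, Binary32),
      (E3M2, Binary16), (E3M2, Binary32), (E2M3, Binary32), (E4M3, Binary32), (E5M2, Binary32),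
      (Binary8p3, Binary32), (Binary8p4, Binary32), (Binary8p5, Binary32),
      (Binary8p3F, Binary32), (Binary8p4F, Binary32)],
      (embedsTest p.1 p.2 && decide (3 * (p.1.manBits + 1) ≤ p.2.manBits + 1)
        && decide (p.1.bias ≤ p.2.bias) && decide (p.2.qexp ≤ 2 * p.1.qexp)
        && decide (p.2.qexp + p.2.manBits + 1 ≤ p.1.qexp) && decide (1 ≤ p.1.manBits)
        && decide (1 ≤ p.1.bias)
        && (decide (p.1.bias + 2 * p.1.manBits ≤ p.2.manBits + 1)
          || decide (2 ^ (p.1.bias + 2 * p.1.manBits) ≤ p.1.maxScaled))) = true ∧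
      (fmaWideTest p.1 p.2 = true ↔
        p ∉ [(E5M2, Binary32), (Binary8p3, Binary32), (Binary8p3F, Binary32)]) := by
    decide +kernel
  intro p hp
  obtain ⟨h, hv⟩ := H p hp
  simp only [Bool.and_eq_true, Bool.or_eq_true, decide_eq_true_eq] at h
  obtain ⟨⟨⟨⟨⟨⟨⟨hE, hm⟩, hb⟩, hq⟩, hn⟩, h1⟩, hb1⟩, hR⟩ := h
  exact ⟨dFma_wide_iff hE hm hb hq hn h1 hb1 hR, hv⟩

/-- THE BINARY64 COLUMN BY THE CRITERION: for the `12` named sources other than binary32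
(`3 P_X ≤ 53`) the hypotheses hold and `DFma X binary64 ↔ X ≠ bfloat16` — the targets below
`2^53` quanta have no midpoint in that binade; bfloat16's binade `2^53` is full and its second
midpoint `259 = 7·37` is factorable (`257` is prime: the first one is harmless).  This re-derives
`dFma_via_binary64` / `not_dFma_bfloat16_binary64` of `DoubleRoundingFMAMatrix.lean` from the
record-level criterion. [this packet] -/
theorem dFma_binary64_iff_wide : ∀ X ∈ namedFormats, X ≠ Binary32 →
    (DFma X Binary64 ↔ X ≠ BFloat16) := by
  have H : ∀ X ∈ namedFormats, X ≠ Binary32 →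
      (embedsTest X Binary64 && decide (3 * (X.manBits + 1) ≤ Binary64.manBits + 1)
        && decide (X.bias ≤ Binary64.bias) && decide (Binary64.qexp ≤ 2 * X.qexp)
        && decide (Binary64.qexp + Binary64.manBits + 1 ≤ X.qexp) && decide (1 ≤ X.manBits)
        && decide (1 ≤ X.bias)
        && (decide (X.bias + 2 * X.manBits ≤ Binary64.manBits + 1)
          || decide (2 ^ (X.bias + 2 * X.manBits) ≤ X.maxScaled))) = true ∧
      (fmaWideTest X Binary64 = true ↔ X ≠ BFloat16) := by
    decide +kernel
  intro X hX hne
  obtain ⟨h, hv⟩ := H X hX hne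
  simp only [Bool.and_eq_true, Bool.or_eq_true, decide_eq_true_eq] at h
  obtain ⟨⟨⟨⟨⟨⟨⟨hE, hm⟩, hb⟩, hq⟩, hn⟩, h1⟩, hb1⟩, hR⟩ := h
  rw [dFma_wide_iff hE hm hb hq hn h1 hb1 hR]; exact hv

end Summit.Ventures.CertifiedArithmetic
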